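import Literature.AnabelianGeometry.SemiGraphs.TemperedCompactPairFixedStar
import Literature.AnabelianGeometry.SemiGraphs.TemperedCompactPairSparse
import Literature.AnabelianGeometry.SemiGraphs.GaloisCoveringTorsor
import Literature.AnabelianGeometry.SemiGraphs.TemperedPiDeckCompact
import HarnessLib

/-!
# Two compact subgroups of `π₁^temp(𝒢)` when the EDGE GROUPS FORM NULL SEQUENCES in the vertex groups: jointly
# compact or ANCHORED — for EVERY countable base graph (the residual of [SemiAnbd] Thm 3.7 (iv) is empty)

Mochizuki, *Semi-graphs of anabelioids*, Publ. RIMS **42** (2006), §2 Rmk. 2.2.1 p. 24 (images of `Π_v`, `Π_b`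
as stabilisers) and §3, Theorem 3.7 (iv) p. 41: "The maximal compact subgroups of `π₁^temp(𝒢)` are precisely the
verticial subgroups. The nontrivial intersections of two distinct maximal compact subgroups of `π₁^temp(𝒢)` are
precisely the edge-like subgroups." [cite: MochizukiSemiAnbd2006, Thm 3.7(iv) p.41].

PROOF-ONLY tool file (abc-iut cell, layer L3, row «T37iv-S2@FINITE-CORE-CLASS» sequel «NULL-EDGE-GROUPS», file F14,
seat abc-iut-L3-t8 gen 12; no definition, no named fact).  Canonical chart of ANY countable `𝒢` with the hypotheses
of Thm 3.7.  Say the edge groups of `𝒢` form *null sequences* (a hypothesis binder below, not a definition) if at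
every vertex `v` every open subgroup of `Π_v` contains the images `Π_b ⊆ Π_v` of all but finitely many branches `b`
at `v` — automatic at vertices of finite valence, true e.g. for `ℤ_p ↪ Ẑ` (`p` varying), false for infinitely many
conjugates of one non-trivial closed subgroup.  This GROUP-THEORETIC class is incomparable with the graph-theoretic
classes of F11/F12 and meets every base graph, ω-cores included:

* `CovObj.finite_fixed_branches_of_ne_one` — at ONE finite Galois level `S` (connected, point-transitive): a
  NON-TRIVIAL `q ∈ Aut S` fixes only FINITELY many branches of `𝔾_S` at any vertex-orbit (abc-iut-L3-t11/d3's
  dictionary `CovObj.stab_brOf_iff`: the stabiliser of a branch over `b` is a conjugate of `ψ_x(Π_b)`, trivial for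
  all but the finitely many `b` with `Π_b ⊄ ker ψ_x`, each carrying finitely many branches of `𝔾_S`);
* ★★★ `isCompact_or_anchored_of_nullEdgeGroups` — two compact subgroups `K₁`, `K₂` with `K₁ ⊓ K₂ ≠ 1` generate a
  compact subgroup or are ANCHORED: otherwise F13 (`exists_infinite_fixed_star_of_no_bridge`) gives at every deep
  level `M` a vertex `z` with INFINITELY many `K₁ ⊓ K₂`-fixed branches, whose images in `𝔾_{S M}` (immersion
  `treeQuot`, square `treeQuot_galAct`) are infinitely many branches fixed by the descent `q_M(g)` of every
  `g ∈ K₁ ⊓ K₂`; so `q_M(g) = 1`, `ρ_M(g)` is a deck transformation fixing `z`, hence trivial (abc-iut-L3-t6's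
  `gal_eq_one_of_descendBaseAut_eq_one_of_fixes`), for all `M ≥ M₀` and then for all `M` (`mapLE_proj`):
  `g = 1` (`pi_ext`) — contradicting `K₁ ⊓ K₂ ≠ 1`;
* ★★ the three ∀-pieces of (iv) OUTRIGHT for the class (`…_of_nullEdgeGroups`).

Honest framing: statements about OUR typed `π₁^temp` at OUR typed carriers; print's Thm 3.7 concerns the graphs of
[SemiAnbd] (finite valence at every vertex, where the binder is vacuous); nothing here bears on [IUTchIII]
Cor. 3.12; no side taken; typed ≠ proved.
-/
noncomputable section

open CategoryTheory Topology

namespace Literature.AnabelianGeometry.SemiGraphs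

open SimpleGraph

universe u

namespace ProfiniteSemiGraph

variable {𝒢 : ProfiniteSemiGraph.{u}}

/-! ### One level: a non-trivial automorphism fixes finitely many branches at a vertex-orbit -/

/-- **At one finite Galois level, a non-trivial automorphism fixes only finitely many branches at a vertex-orbit**
when the edge groups at the base vertex form a null sequence: by the dictionary `CovObj.stab_brOf_iff` the
stabiliser of a branch of `𝔾_S` over `b` is a conjugate of `ψ_x(Π_b)`, which is trivial as soon as `Π_b` lies in the
open kernel of `ψ_x`; the finitely many other `b` carry finitely many branches of `𝔾_S`.
[cite: MochizukiSemiAnbd2006, Rmk. 2.2.1 p.24] -/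
theorem CovObj.finite_fixed_branches_of_ne_one (S : CovObj 𝒢)
    (hconn : ∀ p q : S.Point, S.SameComponent p q)
    (htrans : ∀ (v : 𝒢.graph.Vertex) (x x' : (S.SV v).obj.V), ∃ σ : S ⟶ S, (σ.fV v).hom.hom x = x')
    (hS : S.IsFinite)
    (hnull : ∀ (v : 𝒢.graph.Vertex) (N : Subgroup (𝒢.Gv v)), IsOpen (N : Set (𝒢.Gv v)) →
      {b : 𝒢.graph.Branch | ∃ hb : 𝒢.graph.abuts b = some v, ¬ 𝒢.branchSubgroup b v hb ≤ N}.Finite)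
    (q : Aut S) (hq : q ≠ 1) (w₀ : S.orbitGraph.Vertex) :
    {β : S.orbitGraph.Branch | S.orbitGraph.abuts β = some w₀ ∧
      (CovObj.orbitGraphMap q.hom).branchMap β = β}.Finite := by
  classical
  by_contra hinf
  -- a fixed branch and a base point `x` of the fibre over the base vertex `u` of `w₀`
  obtain ⟨β₀, hβ₀w, -⟩ := Set.Infinite.nonempty hinf
  have hc₀ : 𝒢.graph.abuts (S.orbitGraphProj.branchMap β₀) = some (S.orbitGraphProj.vertexMap w₀) :=
    S.orbitGraphProj.abuts_branchMap β₀ w₀ hβ₀w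
  obtain ⟨x, -⟩ := S.exists_eq_brOf (S.orbitGraphProj.branchMap β₀) hc₀ β₀ rfl
  -- the open kernel of `ψ_x` contains all but finitely many edge groups at `u`
  have hExc := hnull (S.orbitGraphProj.vertexMap w₀) (S.ptHom hconn htrans x).ker (S.isOpen_ker_ptHom hconn htrans x)
  -- every `q`-fixed branch at `w₀` lies over an exceptional base branch
  refine hinf ((hExc.biUnion fun c _ => S.finite_orbitGraph_branch_over hS c).subset ?_)
  rintro β ⟨hβw, hβq⟩
  simp only [Set.mem_iUnion, Set.mem_setOf_eq, exists_prop]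
  have hc : 𝒢.graph.abuts (S.orbitGraphProj.branchMap β) = some (S.orbitGraphProj.vertexMap w₀) :=
    S.orbitGraphProj.abuts_branchMap β w₀ hβw
  refine ⟨S.orbitGraphProj.branchMap β, ⟨hc, fun hle => hq ?_⟩, rfl⟩
  -- over a branch `c` with `ψ_x(Π_c) = 1` the stabiliser of every branch of `𝔾_S` is trivial
  obtain ⟨y, hy⟩ := S.exists_eq_brOf (S.orbitGraphProj.branchMap β) hc β rfl
  obtain ⟨σ, hσ⟩ := S.exists_aut_fV_eq hconn htrans x y
  rw [hy, ← hσ] at hβq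
  have hmem := (S.stab_brOf_iff hconn htrans x σ q).mp hβq
  have hbot : (𝒢.branchSubgroup (S.orbitGraphProj.branchMap β) _ hc).map (S.ptHom hconn htrans x) = ⊥ := by
    rw [eq_bot_iff]
    rintro _ ⟨k, hk, rfl⟩
    exact Subgroup.mem_bot.mpr (MonoidHom.mem_ker.mp (hle hk))
  rw [hbot, Subgroup.map_bot] at hmem
  exact Subgroup.mem_bot.mp hmem

/-! ### ★★★ Null edge groups: jointly compact or anchored, at every base graph -/

section NullEdgeGroups

variable (h37 : 𝒢.Thm37Hypotheses)

/-- ★★★ **When the edge groups form null sequences in the vertex groups, two compact subgroups of `π₁^temp(𝒢)`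
meeting non-trivially generate a compact subgroup or are ANCHORED — whatever the countable base graph.**  In the
third regime F13 provides, at every bridge-free level `M`, a vertex `z` of `𝒢_{∞,M}` with infinitely many
`K₁ ⊓ K₂`-fixed branches; their images in the finite level `𝔾_{S M}` are infinitely many branches fixed by the
descent of `ρ_M(g)`, `g ∈ K₁ ⊓ K₂`, which is therefore trivial (`CovObj.finite_fixed_branches_of_ne_one`); a deck
transformation fixing `z` is trivial, so `ρ_M(g) = 1` for all large `M`, whence `g = 1`: `K₁ ⊓ K₂ = 1`, a
contradiction. [cite: MochizukiSemiAnbd2006, Thm 3.7(iv) p.41] -/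
theorem isCompact_or_anchored_of_nullEdgeGroups
    (hnull : ∀ (v : 𝒢.graph.Vertex) (N : Subgroup (𝒢.Gv v)), IsOpen (N : Set (𝒢.Gv v)) →
      {b : 𝒢.graph.Branch | ∃ hb : 𝒢.graph.abuts b = some v, ¬ 𝒢.branchSubgroup b v hb ≤ N}.Finite)
    (K₁ K₂ : Subgroup ((𝒢.galoisLevelData h37.toProp36Hypotheses).temperedPi h37.toProp36Hypotheses.isCountable))
    (hK₁ : IsCompact (K₁ : Set ((𝒢.galoisLevelData h37.toProp36Hypotheses).temperedPi h37.toProp36Hypotheses.isCountable)))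
    (hK₂ : IsCompact (K₂ : Set ((𝒢.galoisLevelData h37.toProp36Hypotheses).temperedPi h37.toProp36Hypotheses.isCountable))) (hne : K₁ ⊓ K₂ ≠ ⊥) :
    IsCompact ((K₁ ⊔ K₂).topologicalClosure : Set ((𝒢.galoisLevelData h37.toProp36Hypotheses).temperedPi h37.toProp36Hypotheses.isCountable)) ∨
    ((∃ (v : 𝒢.graph.Vertex) (H : Subgroup (𝒢.temperedPiChart h37.toProp36Hypotheses).G),
        H ∈ verticialSubgroups (𝒢.temperedPiChart h37.toProp36Hypotheses) v ∧ K₁ ≤ H) ∧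
      (∃ (v : 𝒢.graph.Vertex) (H : Subgroup (𝒢.temperedPiChart h37.toProp36Hypotheses).G),
        H ∈ verticialSubgroups (𝒢.temperedPiChart h37.toProp36Hypotheses) v ∧ K₂ ≤ H) ∧
      ∃ (e : 𝒢.graph.Edge) (L : Subgroup (𝒢.temperedPiChart h37.toProp36Hypotheses).G),
        L ∈ edgeLikeSubgroups (𝒢.temperedPiChart h37.toProp36Hypotheses) e ∧ K₁ ⊓ K₂ ≤ L) := by
  classical
  have h36 := h37.toProp36Hypotheses
  let Dg := 𝒢.galoisLevelData h36
  have hc := h36.isCountable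
  have hconnL := 𝒢.galoisLevelData_hconn h36
  let D₀ : VerticialLevelData.{0} 𝒢 (𝒢.temperedPiChart h36) := verticialLevelData_temperedPiChart (h36 := h36)
  by_cases hK : IsCompact (((K₁ ⊔ K₂).topologicalClosure : Subgroup (Dg.temperedPi hc)) : Set (Dg.temperedPi hc))
  · exact Or.inl hK
  right
  -- some level `m` without a common fixed vertex (F1)
  obtain ⟨m, hm⟩ : ∃ m : ℕ, ∀ z : (Dg.tree m).Vertex,
      (∀ k ∈ K₁, (Dg.treeAct hc m k).hom.vertexMap z = z) → ¬ ∀ k ∈ K₂, (Dg.treeAct hc m k).hom.vertexMap z = z := by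
    by_contra h
    push Not at h
    exact hK (isCompact_topologicalClosure_sup_of_forall_exists_common_fixed_vertex h36 K₁ K₂
      fun m => by obtain ⟨z, hz₁, hz₂⟩ := h m; exact ⟨z, hz₁, hz₂⟩)
  by_cases hbr : ∀ M : ℕ, m ≤ M → ∃ (x y : (Dg.tree M).Vertex) (β₁ β₂ : (Dg.tree M).Branch), β₁ ≠ β₂ ∧
      (Dg.tree M).edgeOf β₁ = (Dg.tree M).edgeOf β₂ ∧ (Dg.tree M).abuts β₁ = some x ∧ (Dg.tree M).abuts β₂ = some y ∧
      (∀ k ∈ K₁, (Dg.treeAct hc M k).hom.vertexMap x = x) ∧ ∀ k ∈ K₂, (Dg.treeAct hc M k).hom.vertexMap y = y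
  · -- bridges at every level `M ≥ m`: the anchored regime (F2)
    obtain ⟨h₁, h₂⟩ := exists_verticial_ge_of_forall_exists_bridge h36 K₁ K₂ m hm hbr
    exact ⟨h₁, h₂, exists_edgeLike_ge_inf_of_forall_exists_bridge h36 K₁ K₂ m hm hbr⟩
  exfalso
  push Not at hbr
  obtain ⟨M₀, hmM₀, hnobr₀⟩ := hbr
  have hno : ∀ {M : ℕ}, M₀ ≤ M → ∀ z : (Dg.tree M).Vertex, (∀ k ∈ K₁, (Dg.treeAct hc M k).hom.vertexMap z = z) →
      ¬ ∀ k ∈ K₂, (Dg.treeAct hc M k).hom.vertexMap z = z :=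
    fun hM z hz => forall_not_common_fixed_of_le h36 K₁ K₂ (hmM₀.trans hM) hm z hz
  have hpushV : ∀ (K : Subgroup (Dg.temperedPi hc)) {M M' : ℕ} (h : M ≤ M') (w : (Dg.tree M').Vertex),
      (∀ k ∈ K, (Dg.treeAct hc M' k).hom.vertexMap w = w) →
      ∀ k ∈ K, (Dg.treeAct hc M k).hom.vertexMap ((Dg.treeTrans h).vertexMap w) = (Dg.treeTrans h).vertexMap w := by
    intro K M M' h w hw k hk
    have e : (Dg.treeTrans h).vertexMap ((Dg.treeAct hc M' k).hom.vertexMap w) =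
        (Dg.treeAct hc M k).hom.vertexMap ((Dg.treeTrans h).vertexMap w) := D₀.trans_act_vertexMap h k w
    rw [hw k hk] at e
    exact e.symm
  -- no bridge at any level `M ≥ M₀` (bridges descend)
  have hnobr : ∀ M : ℕ, M₀ ≤ M → ¬ ∃ (x y : (Dg.tree M).Vertex) (β₁ β₂ : (Dg.tree M).Branch), β₁ ≠ β₂ ∧
      (Dg.tree M).edgeOf β₁ = (Dg.tree M).edgeOf β₂ ∧ (Dg.tree M).abuts β₁ = some x ∧ (Dg.tree M).abuts β₂ = some y ∧
      (∀ k ∈ K₁, (Dg.treeAct hc M k).hom.vertexMap x = x) ∧ ∀ k ∈ K₂, (Dg.treeAct hc M k).hom.vertexMap y = y := by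
    rintro M hM ⟨x, y, β₁, β₂, h12, he, hx, hy, hxK, hyK⟩
    let π := Dg.treeTrans hM
    obtain ⟨k, hk, hne'⟩ := hnobr₀ (π.vertexMap x) (π.vertexMap y) (π.branchMap β₁) (π.branchMap β₂)
      (fun h => h12 (π.branchMap_injOn _ _ he h)) (by rw [π.edgeOf_branchMap, π.edgeOf_branchMap, he])
      (π.abuts_branchMap _ _ hx) (π.abuts_branchMap _ _ hy) (hpushV K₁ hM x hxK)
    exact hne' (hpushV K₂ hM y hyK k hk)
  -- a non-trivial element of the compact `K₁ ⊓ K₂`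
  obtain ⟨g, hgC, hg1⟩ : ∃ g ∈ K₁ ⊓ K₂, g ≠ 1 := by
    by_contra h
    push Not at h
    exact hne ((Subgroup.eq_bot_iff_forall _).mpr h)
  -- `ρ_M(g) = 1` at every level `M ≥ M₀`
  have hproj : ∀ M : ℕ, M₀ ≤ M → Dg.proj hc M g = 1 := by
    intro M hM
    obtain ⟨z, -, -, hinf⟩ := exists_infinite_fixed_star_of_no_bridge h37 K₁ K₂ hK₁ hK₂ hne M (hno hM) (hnobr M hM)
    -- `g` fixes a branch at `z`, hence `z`
    obtain ⟨γ₀, hγ₀z, hγ₀fix⟩ := Set.Infinite.nonempty hinf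
    have hgz : (Dg.treeAct hc M g).hom.vertexMap z = z := by
      have h := (Dg.treeAct hc M g).hom.abuts_branchMap γ₀ z hγ₀z
      rw [hγ₀fix g hgC] at h
      exact (Option.some.inj (hγ₀z.symm.trans h)).symm
    -- the descent `q` of `ρ_M(g)` to the finite level `S M`
    let S := Dg.S M
    let q : Aut S := S.descendBaseAut hc (Dg.W M) (Dg.htrans M) (hconnL M) (Dg.proj hc M g)
    by_cases hq : q = 1
    · exact Dg.gal_eq_one_of_descendBaseAut_eq_one_of_fixes hc hconnL M (Dg.proj hc M g) hq z hgz
    exfalso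
    -- the images in `𝔾_{S M}` of the `K₁ ⊓ K₂`-fixed branches at `z` are `q`-fixed branches at `z̄`: infinitely many
    have hfin := S.finite_fixed_branches_of_ne_one (hconnL M) (Dg.htrans M) (𝒢.galoisLevelData_isFinite h36 M)
      hnull q hq ((Dg.treeQuot M).vertexMap z)
    have hsq : ∀ γ : (Dg.tree M).Branch, (Dg.treeQuot M).branchMap ((Dg.treeAct hc M g).hom.branchMap γ) =
        (CovObj.orbitGraphMap q.hom).branchMap ((Dg.treeQuot M).branchMap γ) := by
      intro γ
      have e := congrArg (fun φ => SemiGraph.Hom.branchMap φ γ) (Dg.treeQuot_galAct hc hconnL M (Dg.proj hc M g))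
      simp only [SemiGraph.comp_branchMap, Function.comp_apply] at e
      rw [Dg.treeAct_apply]
      exact e.trans rfl
    have hinj : Set.InjOn (Dg.treeQuot M).branchMap {γ : (Dg.tree M).Branch | (Dg.tree M).abuts γ = some z ∧
        ∀ g ∈ K₁ ⊓ K₂, (Dg.treeAct hc M g).hom.branchMap γ = γ} := by
      rintro γ ⟨hγ, -⟩ γ' ⟨hγ', -⟩ h
      have hinj := Dg.treeQuot_isImmersion M z
      have h' : SemiGraph.Hom.starMap (Dg.treeQuot M) z ⟨γ, hγ⟩ =
          SemiGraph.Hom.starMap (Dg.treeQuot M) z ⟨γ', hγ'⟩ := Subtype.ext h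
      exact congrArg Subtype.val (hinj h')
    have hsub : (Dg.treeQuot M).branchMap '' {γ : (Dg.tree M).Branch | (Dg.tree M).abuts γ = some z ∧
        ∀ g ∈ K₁ ⊓ K₂, (Dg.treeAct hc M g).hom.branchMap γ = γ} ⊆ {β : S.orbitGraph.Branch |
        S.orbitGraph.abuts β = some ((Dg.treeQuot M).vertexMap z) ∧ (CovObj.orbitGraphMap q.hom).branchMap β = β} := by
      rintro _ ⟨γ, ⟨hγz, hγfix⟩, rfl⟩
      refine ⟨(Dg.treeQuot M).abuts_branchMap γ z hγz, ?_⟩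
      rw [← hsq γ, hγfix g hgC]
    exact absurd (hfin.subset hsub) (Set.Infinite.image hinj hinf)
  -- hence `ρ_n(g) = 1` at every level and `g = 1`
  refine hg1 (Dg.pi_ext hc fun n => ?_)
  rw [map_one]
  rcases le_or_gt M₀ n with h | h
  · exact hproj n h
  · rw [← Dg.mapLE_proj hc h.le g, hproj M₀ le_rfl, map_one]

/-- ★★ **THE NON-NULL RESIDUAL.**  If two compact subgroups of `π₁^temp(𝒢)` meeting non-trivially neither generate a
compact subgroup nor are anchored, then some vertex group `Π_v` has an OPEN subgroup missing INFINITELY many of the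
branch subgroups `Π_b` (`b` at `v`) — the edge groups at `v` do not form a null sequence (contrapositive handle of
`isCompact_or_anchored_of_nullEdgeGroups`; combine with F12's `exists_omegaCore_of_not_isCompact_of_not_anchored`).
[cite: MochizukiSemiAnbd2006, Thm 3.7(iv) p.41] -/
theorem exists_not_null_of_not_isCompact_of_not_anchored
    (K₁ K₂ : Subgroup ((𝒢.galoisLevelData h37.toProp36Hypotheses).temperedPi h37.toProp36Hypotheses.isCountable))
    (hK₁ : IsCompact (K₁ : Set ((𝒢.galoisLevelData h37.toProp36Hypotheses).temperedPi h37.toProp36Hypotheses.isCountable)))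
    (hK₂ : IsCompact (K₂ : Set ((𝒢.galoisLevelData h37.toProp36Hypotheses).temperedPi h37.toProp36Hypotheses.isCountable))) (hne : K₁ ⊓ K₂ ≠ ⊥)
    (hK : ¬ IsCompact ((K₁ ⊔ K₂).topologicalClosure : Set ((𝒢.galoisLevelData h37.toProp36Hypotheses).temperedPi h37.toProp36Hypotheses.isCountable)))
    (hna : ¬ ((∃ (v : 𝒢.graph.Vertex) (H : Subgroup (𝒢.temperedPiChart h37.toProp36Hypotheses).G),
        H ∈ verticialSubgroups (𝒢.temperedPiChart h37.toProp36Hypotheses) v ∧ K₁ ≤ H) ∧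
      (∃ (v : 𝒢.graph.Vertex) (H : Subgroup (𝒢.temperedPiChart h37.toProp36Hypotheses).G),
        H ∈ verticialSubgroups (𝒢.temperedPiChart h37.toProp36Hypotheses) v ∧ K₂ ≤ H) ∧
      ∃ (e : 𝒢.graph.Edge) (L : Subgroup (𝒢.temperedPiChart h37.toProp36Hypotheses).G),
        L ∈ edgeLikeSubgroups (𝒢.temperedPiChart h37.toProp36Hypotheses) e ∧ K₁ ⊓ K₂ ≤ L)) :
    ∃ (v : 𝒢.graph.Vertex) (N : Subgroup (𝒢.Gv v)), IsOpen (N : Set (𝒢.Gv v)) ∧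
      ¬ {b : 𝒢.graph.Branch | ∃ hb : 𝒢.graph.abuts b = some v, ¬ 𝒢.branchSubgroup b v hb ≤ N}.Finite := by
  by_contra h
  push Not at h
  rcases isCompact_or_anchored_of_nullEdgeGroups h37 (fun v N hN => h v N hN) K₁ K₂ hK₁ hK₂ hne with hc | ha
  · exact hK hc
  · exact hna ha

/-! ### ★★ The three ∀-pieces of Thm 3.7 (iv) OUTRIGHT when the edge groups form null sequences -/

/-- ★★ **ANCHORED PACKAGE** (null edge groups): a compact subgroup `K` of `π₁^temp(𝒢)` meeting a VERTICIAL subgroup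
`H` non-trivially lies in SOME verticial subgroup. [cite: MochizukiSemiAnbd2006, Thm 3.7(iv) p.41] -/
theorem exists_verticial_ge_of_inf_verticial_ne_bot_of_nullEdgeGroups {v : 𝒢.graph.Vertex}
    (hnull : ∀ (v : 𝒢.graph.Vertex) (N : Subgroup (𝒢.Gv v)), IsOpen (N : Set (𝒢.Gv v)) →
      {b : 𝒢.graph.Branch | ∃ hb : 𝒢.graph.abuts b = some v, ¬ 𝒢.branchSubgroup b v hb ≤ N}.Finite)
    (H K : Subgroup ((𝒢.galoisLevelData h37.toProp36Hypotheses).temperedPi h37.toProp36Hypotheses.isCountable))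
    (hH : H ∈ verticialSubgroups (𝒢.temperedPiChart h37.toProp36Hypotheses) v)
    (hK : IsCompact (K : Set ((𝒢.galoisLevelData h37.toProp36Hypotheses).temperedPi h37.toProp36Hypotheses.isCountable))) (hne : H ⊓ K ≠ ⊥) :
    ∃ (w : 𝒢.graph.Vertex) (H' : Subgroup (𝒢.temperedPiChart h37.toProp36Hypotheses).G),
      H' ∈ verticialSubgroups (𝒢.temperedPiChart h37.toProp36Hypotheses) w ∧ K ≤ H' := by
  have h36 := h37.toProp36Hypotheses
  have hHc : IsCompact (H : Set ((𝒢.galoisLevelData h36).temperedPi h36.isCountable)) :=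
    isCompact_of_mem_verticialSubgroups (𝒢.temperedPiChart h36) hH
  rcases isCompact_or_anchored_of_nullEdgeGroups h37 hnull H K hHc hK hne with hcpt | ⟨-, hK', -⟩
  · have hle : H ≤ (H ⊔ K).topologicalClosure := le_sup_left.trans (Subgroup.le_topologicalClosure _)
    have heq := eq_of_verticial_le_compact h37 (𝒢.temperedPiChart h36) hH hcpt hle
    exact ⟨v, H, hH, (le_sup_right.trans (Subgroup.le_topologicalClosure _)).trans heq.le⟩
  · exact hK'

/-- ★★ **ISOLATION** (null edge groups): a compact subgroup `K` meeting an EXOTIC maximal compact subgroup `K₀` (one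
lying in no verticial subgroup) non-trivially lies in `K₀`. [cite: MochizukiSemiAnbd2006, Thm 3.7(iv) p.41] -/
theorem le_of_isMaximalCompactSubgroup_of_exotic_of_nullEdgeGroups
    (hnull : ∀ (v : 𝒢.graph.Vertex) (N : Subgroup (𝒢.Gv v)), IsOpen (N : Set (𝒢.Gv v)) →
      {b : 𝒢.graph.Branch | ∃ hb : 𝒢.graph.abuts b = some v, ¬ 𝒢.branchSubgroup b v hb ≤ N}.Finite)
    (K K₀ : Subgroup ((𝒢.galoisLevelData h37.toProp36Hypotheses).temperedPi h37.toProp36Hypotheses.isCountable))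
    (hK : IsCompact (K : Set ((𝒢.galoisLevelData h37.toProp36Hypotheses).temperedPi h37.toProp36Hypotheses.isCountable))) (hK₀ : IsMaximalCompactSubgroup K₀)
    (hK₀ex : ∀ (w : 𝒢.graph.Vertex) (H' : Subgroup (𝒢.temperedPiChart h37.toProp36Hypotheses).G),
      H' ∈ verticialSubgroups (𝒢.temperedPiChart h37.toProp36Hypotheses) w → ¬ K₀ ≤ H')
    (hne : K ⊓ K₀ ≠ ⊥) : K ≤ K₀ := by
  rcases isCompact_or_anchored_of_nullEdgeGroups h37 hnull K K₀ hK hK₀.1 hne with hcpt | ⟨-, ⟨w, H', hH', hK₀H'⟩, -⟩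
  · have hle₀ : K₀ ≤ (K ⊔ K₀).topologicalClosure := le_sup_right.trans (Subgroup.le_topologicalClosure _)
    have heq := hK₀.2 _ hcpt hle₀
    exact (le_sup_left.trans (Subgroup.le_topologicalClosure _)).trans heq.le
  · exact absurd hK₀H' (hK₀ex w H' hH')

/-- ★★ **An exotic maximal compact subgroup meets every OTHER maximal compact subgroup trivially** (null edge
groups). [cite: MochizukiSemiAnbd2006, Thm 3.7(iv) p.41] -/
theorem inf_eq_bot_of_isMaximalCompactSubgroup_of_exotic_of_ne_of_nullEdgeGroups
    (hnull : ∀ (v : 𝒢.graph.Vertex) (N : Subgroup (𝒢.Gv v)), IsOpen (N : Set (𝒢.Gv v)) →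
      {b : 𝒢.graph.Branch | ∃ hb : 𝒢.graph.abuts b = some v, ¬ 𝒢.branchSubgroup b v hb ≤ N}.Finite)
    (K K₀ : Subgroup ((𝒢.galoisLevelData h37.toProp36Hypotheses).temperedPi h37.toProp36Hypotheses.isCountable))
    (hK : IsMaximalCompactSubgroup K) (hK₀ : IsMaximalCompactSubgroup K₀)
    (hK₀ex : ∀ (w : 𝒢.graph.Vertex) (H' : Subgroup (𝒢.temperedPiChart h37.toProp36Hypotheses).G),
      H' ∈ verticialSubgroups (𝒢.temperedPiChart h37.toProp36Hypotheses) w → ¬ K₀ ≤ H')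
    (hKK₀ : K ≠ K₀) : K ⊓ K₀ = ⊥ := by
  by_contra hne
  have hle : K ≤ K₀ :=
    le_of_isMaximalCompactSubgroup_of_exotic_of_nullEdgeGroups h37 hnull K K₀ hK.1 hK₀ hK₀ex hne
  exact hKK₀ (hK.2 K₀ hK₀.1 hle).symm

/-- ★★★ **THM 3.7 (iv), SECOND SENTENCE, when the edge groups form null sequences — at EVERY countable base graph**:
two DISTINCT maximal compact subgroups of `π₁^temp(𝒢)` meeting non-trivially are BOTH VERTICIAL and their
intersection lies in an EDGE-LIKE subgroup. [cite: MochizukiSemiAnbd2006, Thm 3.7(iv) p.41] -/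
theorem verticial_of_isMaximalCompactSubgroup_of_ne_of_nullEdgeGroups
    (hnull : ∀ (v : 𝒢.graph.Vertex) (N : Subgroup (𝒢.Gv v)), IsOpen (N : Set (𝒢.Gv v)) →
      {b : 𝒢.graph.Branch | ∃ hb : 𝒢.graph.abuts b = some v, ¬ 𝒢.branchSubgroup b v hb ≤ N}.Finite)
    (K₁ K₂ : Subgroup ((𝒢.galoisLevelData h37.toProp36Hypotheses).temperedPi h37.toProp36Hypotheses.isCountable))
    (hK₁ : IsMaximalCompactSubgroup K₁) (hK₂ : IsMaximalCompactSubgroup K₂) (hne₁₂ : K₁ ≠ K₂)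
    (hne : K₁ ⊓ K₂ ≠ ⊥) :
    (∃ v : 𝒢.graph.Vertex, K₁ ∈ verticialSubgroups (𝒢.temperedPiChart h37.toProp36Hypotheses) v) ∧
      (∃ v : 𝒢.graph.Vertex, K₂ ∈ verticialSubgroups (𝒢.temperedPiChart h37.toProp36Hypotheses) v) ∧
      ∃ (e : 𝒢.graph.Edge) (L : Subgroup (𝒢.temperedPiChart h37.toProp36Hypotheses).G),
        L ∈ edgeLikeSubgroups (𝒢.temperedPiChart h37.toProp36Hypotheses) e ∧ K₁ ⊓ K₂ ≤ L := by
  rcases isCompact_or_anchored_of_nullEdgeGroups h37 hnull K₁ K₂ hK₁.1 hK₂.1 hne with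
    hcpt | ⟨⟨v₁, H₁, hH₁, hK₁H₁⟩, ⟨v₂, H₂, hH₂, hK₂H₂⟩, hedge⟩
  · have h₁ := hK₁.2 _ hcpt (le_sup_left.trans (Subgroup.le_topologicalClosure _))
    have h₂ := hK₂.2 _ hcpt (le_sup_right.trans (Subgroup.le_topologicalClosure _))
    exact absurd (h₁.symm.trans h₂) hne₁₂
  · have h₁ : K₁ = H₁ := le_antisymm hK₁H₁ ((hK₁.2 H₁ (isCompact_of_mem_verticialSubgroups _ hH₁) hK₁H₁).le)
    have h₂ : K₂ = H₂ := le_antisymm hK₂H₂ ((hK₂.2 H₂ (isCompact_of_mem_verticialSubgroups _ hH₂) hK₂H₂).le)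
    exact ⟨⟨v₁, h₁ ▸ hH₁⟩, ⟨v₂, h₂ ▸ hH₂⟩, hedge⟩

/-- **Finite valence is vacuous for the binder**: at a LOCALLY FINITE graph the edge groups trivially form null
sequences, so F4's `isCompact_or_anchored_of_isLocallyFinite` is a special case of
`isCompact_or_anchored_of_nullEdgeGroups`. [cite: MochizukiSemiAnbd2006, Thm 3.7(iv) p.41] -/
theorem nullEdgeGroups_of_isLocallyFinite (hlf : 𝒢.graph.IsLocallyFinite) :
    ∀ (v : 𝒢.graph.Vertex) (N : Subgroup (𝒢.Gv v)), IsOpen (N : Set (𝒢.Gv v)) →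
      {b : 𝒢.graph.Branch | ∃ hb : 𝒢.graph.abuts b = some v, ¬ 𝒢.branchSubgroup b v hb ≤ N}.Finite :=
  fun v _ _ => (𝒢.finite_branches_of_isLocallyFinite hlf v).subset fun _ hb => hb.1

end NullEdgeGroups

end ProfiniteSemiGraph

end Literature.AnabelianGeometry.SemiGraphs

end
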